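import Mathlib
import Literature.Analysis.ODE.SaddleEscapeComparison
import Literature.Geometry.Lorentzian.ReggeWheelerTortoise
import Summits.FinalStateConjecture.FinalStateConjecture.Theorems.PhotonSphereChannelsCauchyWaveGlobal
import Summits.FinalStateConjecture.FinalStateConjecture.Theorems.PhotonSphereChannelsWindowedShellChannelsLagLawPotential
import Summits.FinalStateConjecture.FinalStateConjecture.Theorems.PhotonSphereChannelsWindowedShellChannelsLagLawPacket
import Summits.FinalStateConjecture.FinalStateConjecture.Theorems.PhotonSphereChannelsWindowedShellChannelsLagLawBeam

/-!
# `WindowedShellChannels` (stmt-FinalStateConjecture-14085), the logarithmic lag law — IV: assembly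

Support file (prover seat 1; everything proved, no definitions). Write `Inner_W(M, ρ, h, c)` for the
body of `Theses.PhotonSphereChannels.WindowedShellChannels` after its two existential quantifiers
(`∃ h ≥ 0, ∃ c > 0`): every Regge–Wheeler solution of spin `s ≤ 2 ≤ …`, `s ≤ ℓ`, with Cauchy data
supported off the shell `{|x − xc| ≤ ρ}` radiates the fraction `c` of its energy through the two
lagged channels `{ρ − h + |t| < |x − xc|}`. The main theorem of this file is the

**logarithmic lag law** (`stub_lagLawLogGrowth`, registered): for every `M > 0` and every
`θ < 3√3` there is `ρ₁ > 0` such that for all `0 < ρ < ρ₁`, all `h` and all `c > 0`,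

  `Inner_W(M, ρ, h, c) → θ · M · log(M/ρ) ≤ h`.

So the lag of ANY valid witness of `WindowedShellChannels` grows at least like
`3√3 M log(M/ρ)·(1 − o(1))` as the excised shell shrinks — `3√3 M = 1/λ` is the Lyapunov time of
the photon sphere in tortoise time — and in particular (`lagLaw_unbounded`) no lag bounded as
`ρ → 0` can serve: every constant-lag form of the crux is refuted. (The crux itself allows `h` to
depend on `ρ` and is not decided here.)

Proof (files I–III of the series and this one). Along the tortoise line the `s = 1` potential is
`ℓ(ℓ+1) q`, `q = (1 − 2M/r)/r²` (`LagLawPotential`): `q` is smooth, even-tempered at the photon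
sphere `xc` with `q(xc) = 1/(27M²)`, `q″(xc) = −2/(729M⁴)`, decreasing beyond it. Fix
`θ < θ′ < 3√3`, `λ′ = 1/(θ′M) > λ`. By continuity of `q, q″` at `xc` there is `D > 0` with
`−q′(x) ≤ 2 q(X₀) λ′² (x − xc)` on `[xc, xc + D]` for every launch point `X₀ ∈ [xc, xc + D]`.
Given `ρ` small and a purported witness `(h, c)` with `h < θ M log(M/ρ)`, launch the cut Gaussian
REST beam of frequency `μ = √(ℓ(ℓ+1))` (`LagLawBeam.beam_package`) at `X₀ = xc + 3ρ` with cut-off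
radius `ρ` (data supported in `ρ < |x − xc|`), and let `T = θ′M log(D/(3ρ))`. The saddle comparison
(`Literature.Analysis.ODE.trajectory_sub_le_cosh`) keeps the beam centre in `[xc + 3ρ, xc + D]` up
to time `T`, hence the beam slab inside the lagged ball `{|x − xc| ≤ ρ − h + T}` because
`h < θ M log(M/ρ) ≤ T − D` for `ρ < ρ₁`. By `LagLaw.stub_lagLawPacket` the two channel energies
of the true solution `ψ` with the beam's Cauchy data (`CauchyWaveGlobal.exists_solution_global`)
are `≤ 2(e−1)T²·2ρB²μ = O(μ)`, while its energy is `≥ 2e^{−1} q₀ μ^{3/2}`; for `ℓ` large this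
contradicts `Inner_W`.
-/

noncomputable section

-- every `Summit.FinalStateConjecture.FinalStateConjecture.…` name repeats the summit = sub-problem
-- segment (D-0017 layout), as in every landed `…Theorems` file of this route
set_option linter.dupNamespace false

namespace Summit.FinalStateConjecture.FinalStateConjecture.Theorems.LagLaw

open Literature.Geometry.Lorentzian Literature.Geometry.Lorentzian.ReggeWheeler
open Literature.Analysis.ODE
open Summit.FinalStateConjecture.FinalStateConjecture.Theorems
open MeasureTheory Set Filter Topology Function
open scoped ENNReal NNReal

/-! ### An elementary inequality -/

/-- The potential term bounds the energy from below: `∫ V ψ(0,·)² ≤ E[ψ](0)` (as `lintegral`s). -/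
theorem lintegral_potential_le_totalEnergy {V : ℝ → ℝ} (ψ : ℝ → ℝ → ℝ) :
    ∫⁻ x, ENNReal.ofReal (V x * ψ 0 x ^ 2) ≤ totalEnergy V ψ 0 := by
  unfold totalEnergy energyDensity
  refine lintegral_mono fun x => ENNReal.ofReal_le_ofReal ?_
  nlinarith [sq_nonneg (deriv (fun τ => ψ τ x) 0), sq_nonneg (deriv (ψ 0) x)]

/-! ### The law for an abstract photon-sphere profile `q` -/

/-- **The logarithmic lag law, abstract form.** `q` is any smooth positive bounded profile with
Lipschitz `q′`, non-increasing on `[0, ∞)`, with `q′(0) = 0`, `q(0) = 1/(27M²)` and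
`q″(0) = −2/(729M⁴)` (the values of the Regge–Wheeler `s = 1` profile at the photon sphere, in
tortoise coordinate centred there); the potentials are `ℓ(ℓ+1)·q`, `ℓ ≥ 1`. -/
theorem lagLaw_core {q : ℝ → ℝ} {M θ Cq : ℝ} (hM : 0 < M) (hθ0 : 0 < θ) (hθ : θ < 3 * Real.sqrt 3)
    (hq : ∀ n : ℕ∞, ContDiff ℝ n q) {K : ℝ≥0} (hK : LipschitzWith K (deriv q))
    (hqpos : ∀ x, 0 < q x) (hqb : ∀ x, |q x| ≤ Cq)
    (hq' : ∀ x, 0 ≤ x → deriv q x ≤ 0) (hq'0 : deriv q 0 = 0) (hq0 : q 0 = 1 / (27 * M ^ 2))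
    (hq''0 : iteratedDeriv 2 q 0 = -2 / (729 * M ^ 4)) :
    ∃ ρ₁ : ℝ, 0 < ρ₁ ∧ ∀ ρ : ℝ, 0 < ρ → ρ < ρ₁ → ∀ h c : ℝ, 0 < c →
      (∀ ℓ : ℕ, 1 ≤ ℓ → ∀ ψ : ℝ → ℝ → ℝ,
        IsSolution (fun x => ((ℓ : ℝ) * ((ℓ : ℝ) + 1)) * q x) ψ →
        CauchyDataSupportedOn ψ {x : ℝ | ρ < |x - 0|} →
        ENNReal.ofReal c * totalEnergy (fun x => ((ℓ : ℝ) * ((ℓ : ℝ) + 1)) * q x) ψ 0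
          ≤ channelEnergy (fun x => ((ℓ : ℝ) * ((ℓ : ℝ) + 1)) * q x) 0 (ρ - h) ψ atTop
            + channelEnergy (fun x => ((ℓ : ℝ) * ((ℓ : ℝ) + 1)) * q x) 0 (ρ - h) ψ atBot) →
      θ * M * Real.log (M / ρ) ≤ h := by
  obtain ⟨lam, D, ρ₁, hlam0, hD0, hρ₁0, hρ₁D, hKD, hhor⟩ :=
    lagLaw_constants hM hθ0 hθ (hq 2) hq'0 hq0 hq''0
  have hcq : Continuous q := (hq 0).continuous
  refine ⟨ρ₁, hρ₁0, ?_⟩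
  intro ρ hρ hρ₁ h c hc hInner
  have hρD : ρ < D / 3 := lt_of_lt_of_le hρ₁ hρ₁D
  by_contra hcon
  rw [not_le] at hcon
  /- (1) the horizon `T` and `h < T − D` -/
  obtain ⟨T, hT⟩ : ∃ T : ℝ, T = Real.log (D / 3 / ρ) / lam := ⟨_, rfl⟩
  have hD3ρ : 1 < D / 3 / ρ := by rw [lt_div_iff₀ hρ]; linarith
  have hlogpos : 0 < Real.log (D / 3 / ρ) := Real.log_pos hD3ρ
  have hT0 : 0 < T := by rw [hT]; positivity
  have hlamT : lam * T = Real.log (D / 3 / ρ) := by rw [hT]; field_simp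
  have hhT : h < T - D := by rw [hT]; exact hcon.trans_le (hhor ρ hρ hρ₁)
  /- (2) the beam package at `X₀ = 3ρ`, cut-off radius `ρ`, horizon `T`; the centre stays in
  `[3ρ, D]` up to time `T` -/
  obtain ⟨X, ξ, hX0, hξ0, hX2, hXH, hξH, hXlip, B, hB0, hBμ⟩ :=
    beam_package (hq 3) hK hqpos (3 * ρ) hρ T
  have hω₀ : 0 < Real.sqrt (q (3 * ρ)) := Real.sqrt_pos.2 (hqpos _)
  have hω₀sq : Real.sqrt (q (3 * ρ)) ^ 2 = q (3 * ρ) := Real.sq_sqrt (hqpos _).le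
  have hKD' : ∀ x ∈ Icc (0 : ℝ) (0 + D),
      -(deriv q x) ≤ 2 * Real.sqrt (q (3 * ρ)) ^ 2 * lam ^ 2 * (x - 0) := by
    intro x hx
    rw [zero_add] at hx
    rw [hω₀sq, sub_zero]
    exact hKD (3 * ρ) ⟨by positivity, by linarith⟩ x hx
  have hcoshT : (3 * ρ - 0) * Real.cosh (lam * T) ≤ D := by
    rw [sub_zero, hlamT]
    -- `cosh y ≤ exp y` for `y = log(D/(3ρ)) ≥ 0`
    have hcosh : Real.cosh (Real.log (D / 3 / ρ)) ≤ Real.exp (Real.log (D / 3 / ρ)) := by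
      rw [Real.cosh_eq]
      have h := Real.exp_le_exp.2 (by linarith : -Real.log (D / 3 / ρ) ≤ Real.log (D / 3 / ρ))
      linarith
    calc 3 * ρ * Real.cosh (Real.log (D / 3 / ρ))
        ≤ 3 * ρ * Real.exp (Real.log (D / 3 / ρ)) := mul_le_mul_of_nonneg_left hcosh (by positivity)
      _ = D := by rw [Real.exp_log (by positivity)]; field_simp
  have hXT : X T ≤ D := by
    have h1 := trajectory_sub_le_cosh (xc := 0) hω₀ hlam0 hX2 hXH hξH hq' hX0 hξ0 (by positivity)
      hKD' hcoshT T ⟨hT0.le, le_rfl⟩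
    rw [sub_zero] at h1
    exact h1.trans hcoshT
  have hXT' : 3 * ρ ≤ X T :=
    (trajectory_monotone (xc := 0) hω₀ hXH hξH hq' hX0 hξ0 (by positivity) T hT0.le).2
  /- (3) a positive lower bound `q₀` of `q` on `[2ρ, 4ρ]`, and the frequency `μ = √(ℓ(ℓ+1))` -/
  obtain ⟨q₀, hq₀, hq₀'⟩ := Literature.Analysis.PDE.exists_pos_le_of_continuous_Icc hcq hqpos
    (3 * ρ - ρ) (3 * ρ + ρ)
  obtain ⟨C₁, hC₁⟩ : ∃ C₁ : ℝ, C₁ = (Real.exp 1 - 1) * T ^ 2 * (2 * ρ * B ^ 2) := ⟨_, rfl⟩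
  obtain ⟨C₂, hC₂⟩ : ∃ C₂ : ℝ, C₂ = q₀ * Real.exp (-1) * 2 := ⟨_, rfl⟩
  have he1 : 0 ≤ Real.exp 1 - 1 := by linarith [Real.add_one_le_exp (1 : ℝ)]
  have hC₁0 : 0 ≤ C₁ := by rw [hC₁]; positivity
  have hC₂0 : 0 < C₂ := by rw [hC₂]; positivity
  obtain ⟨A₀, hA₀⟩ : ∃ A₀ : ℝ, A₀ = 2 * C₁ / (c * C₂) := ⟨_, rfl⟩
  have hA₀0 : 0 ≤ A₀ := by rw [hA₀]; positivity
  obtain ⟨ℓ, hℓ⟩ : ∃ ℓ : ℕ, ℓ = ⌈max (4 / ρ ^ 2) (A₀ ^ 2)⌉₊ + 1 := ⟨_, rfl⟩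
  have hℓ1 : 1 ≤ ℓ := by rw [hℓ]; exact Nat.le_add_left 1 _
  have hℓR : max (4 / ρ ^ 2) (A₀ ^ 2) + 1 ≤ (ℓ : ℝ) := by
    rw [hℓ]; push_cast
    linarith [Nat.le_ceil (max (4 / ρ ^ 2) (A₀ ^ 2))]
  have hℓpos : (0 : ℝ) < ℓ := by exact_mod_cast hℓ1
  obtain ⟨μ, hμ⟩ : ∃ μ : ℝ, μ = Real.sqrt ((ℓ : ℝ) * ((ℓ : ℝ) + 1)) := ⟨_, rfl⟩
  have hμsq : μ ^ 2 = (ℓ : ℝ) * ((ℓ : ℝ) + 1) := by rw [hμ, Real.sq_sqrt (by positivity)]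
  have hμℓ : (ℓ : ℝ) ≤ μ := by
    rw [hμ]
    calc (ℓ : ℝ) = Real.sqrt ((ℓ : ℝ) ^ 2) := (Real.sqrt_sq hℓpos.le).symm
      _ ≤ Real.sqrt ((ℓ : ℝ) * ((ℓ : ℝ) + 1)) := Real.sqrt_le_sqrt (by nlinarith)
  have hμ1 : 1 ≤ μ := le_trans (by exact_mod_cast hℓ1) hμℓ
  have hμ0 : 0 < μ := by linarith
  have hμ4 : 4 / ρ ^ 2 ≤ μ := by linarith [le_max_left (4 / ρ ^ 2) (A₀ ^ 2)]
  have hμA : A₀ < Real.sqrt μ := by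
    have h1 : A₀ ^ 2 < μ := by linarith [le_max_right (4 / ρ ^ 2) (A₀ ^ 2)]
    calc A₀ = Real.sqrt (A₀ ^ 2) := (Real.sqrt_sq hA₀0).symm
      _ < Real.sqrt μ := Real.sqrt_lt_sqrt (sq_nonneg _) h1
  /- (4) the cut beam `G`, the true solution `ψ` with its data -/
  obtain ⟨G, hGC, hG0, hGt0, hres, hlowG⟩ := hBμ μ hμ1 hμ4
  have hVeq : (fun x => ((ℓ : ℝ) * ((ℓ : ℝ) + 1)) * q x) = fun x => μ ^ 2 * q x := by
    funext x; rw [hμsq]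
  have hV1 : ContDiff ℝ 1 fun x => μ ^ 2 * q x := contDiff_const.mul (hq 1)
  have hV0 : ∀ x, 0 ≤ μ ^ 2 * q x := fun x => by positivity [hqpos x]
  have hVb : ∀ x, |μ ^ 2 * q x| ≤ μ ^ 2 * Cq := fun x => by
    rw [abs_mul, abs_of_nonneg (sq_nonneg μ)]
    exact mul_le_mul_of_nonneg_left (hqb x) (sq_nonneg μ)
  have hA : ContDiff ℝ 2 (G 0) := hGC.comp (contDiff_const.prodMk contDiff_id)
  obtain ⟨ψ, hψC, hψeq, hψ0, hψ1⟩ := CauchyWaveGlobal.exists_solution_global hV1 hVb hV0 hA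
    (contDiff_const (c := (0 : ℝ)))
  have hψsol : IsSolution (fun x => μ ^ 2 * q x) ψ := ⟨hψC, fun z => hψeq z.1 z.2⟩
  have hψ1' : ∀ x, deriv (fun τ => ψ τ x) 0 = 0 := fun x => hψ1 x
  have hdata : CauchyDataSupportedOn ψ {x : ℝ | ρ < |x - 0|} := by
    intro x hx
    simp only [mem_setOf_eq, not_lt, sub_zero] at hx
    refine ⟨?_, hψ1' x⟩
    rw [hψ0]
    apply hG0
    rw [hX0]
    have hxρ : x ≤ ρ := (le_abs_self x).trans hx
    rw [abs_of_nonpos (by linarith)]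
    linarith
  -- the purported witness, at level `ℓ`, for `ψ`
  have hI := hInner ℓ hℓ1 ψ (by rw [hVeq]; exact hψsol) hdata
  rw [hVeq] at hI
  /- (5) upper bound of the two channels, lower bound of the energy -/
  have hres' : ∀ t ∈ Icc 0 T, ∫ x, (iteratedDeriv 2 (fun τ => G τ x) t - iteratedDeriv 2 (G t) x
      + (fun x => μ ^ 2 * q x) x * G t x) ^ 2 ≤ 2 * ρ * (B ^ 2 * μ) := hres
  have hN2 : 0 ≤ 2 * ρ * (B ^ 2 * μ) := by positivity
  have ha : 0 ≤ ρ - h + T := by linarith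
  have hball : ∀ x, ρ - h + |T| < |x - 0| → ρ < |x - X T| := by
    intro x hx
    rw [sub_zero, abs_of_pos hT0] at hx
    rcases le_or_gt 0 x with hx0 | hx0
    · rw [abs_of_nonneg hx0] at hx
      rw [abs_of_pos (by linarith)]
      linarith
    · rw [abs_of_neg hx0] at hx
      rw [abs_of_neg (by linarith)]
      linarith
  have hup := channelEnergy_add_le_of_beam hV1 hV0 hGC hX2.continuous hXlip hG0 hGt0 hρ hT0 hN2
    hres' hψsol hψ0 hψ1' ha hball
  have hlow : ENNReal.ofReal (μ ^ 2 * q₀ * Real.exp (-1) * (2 / Real.sqrt μ))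
      ≤ totalEnergy (fun x => μ ^ 2 * q x) ψ 0 := by
    refine (hlowG q₀ hq₀.le hq₀').trans ?_
    refine le_trans (le_of_eq ?_) (lintegral_potential_le_totalEnergy (V := fun x => μ ^ 2 * q x) ψ)
    refine lintegral_congr fun x => ?_
    rw [hψ0]
  /- (6) `c · E_low ≤ 2 · E_err`, contradicting the choice of `ℓ` -/
  have hfin : ENNReal.ofReal (c * (μ ^ 2 * q₀ * Real.exp (-1) * (2 / Real.sqrt μ)))
      ≤ ENNReal.ofReal (2 * ((Real.exp 1 - 1) * T ^ 2 * (2 * ρ * (B ^ 2 * μ)))) := by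
    rw [ENNReal.ofReal_mul hc.le, ENNReal.ofReal_mul (by norm_num : (0 : ℝ) ≤ 2),
      ENNReal.ofReal_ofNat]
    exact (mul_le_mul' le_rfl hlow).trans (hI.trans hup)
  have hreal := (ENNReal.ofReal_le_ofReal_iff (by positivity)).1 hfin
  obtain ⟨s, hs⟩ : ∃ s : ℝ, s = Real.sqrt μ := ⟨_, rfl⟩
  have hs0 : 0 < s := by rw [hs]; exact Real.sqrt_pos.2 hμ0
  have hμs : μ = s ^ 2 := by rw [hs, Real.sq_sqrt hμ0.le]
  have hkey : 2 * C₁ < s * (c * C₂) := by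
    have h1 := hμA
    rw [← hs, hA₀, div_lt_iff₀ (by positivity)] at h1
    linarith
  have eL : c * (μ ^ 2 * q₀ * Real.exp (-1) * (2 / Real.sqrt μ)) = s ^ 2 * (s * (c * C₂)) := by
    rw [← hs, hμs, hC₂]; field_simp
  have eR : 2 * ((Real.exp 1 - 1) * T ^ 2 * (2 * ρ * (B ^ 2 * s ^ 2))) = s ^ 2 * (2 * C₁) := by
    rw [hC₁]; ring
  rw [eL, hμs, eR] at hreal
  exact absurd (mul_lt_mul_of_pos_left hkey (pow_pos hs0 2)) (not_lt.2 hreal)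

/-! ### The Regge–Wheeler law -/

/-- **Registered sub-goal `stub_lagLawLogGrowth` of stmt-FinalStateConjecture-14085 — the
logarithmic lag law.** For every `M > 0` and `θ < 3√3` there is `ρ₁ > 0` such that for all
`0 < ρ < ρ₁`, every lag `h` and rate `c > 0` for which the body of
`Theses.PhotonSphereChannels.WindowedShellChannels` holds satisfy `θ M log(M/ρ) ≤ h`: the lag of
any witness of the crux grows at least like the photon-sphere Lyapunov time `3√3 M` times
`log(M/ρ)`. See the module docstring for the proof. -/
theorem stub_lagLawLogGrowth : ∀ M : ℝ, 0 < M → ∀ θ : ℝ, θ < 3 * Real.sqrt 3 → ∃ ρ₁ : ℝ, 0 < ρ₁ ∧ ∀ ρ : ℝ, 0 < ρ → ρ < ρ₁ → ∀ h c : ℝ, 0 < c → (∀ (r : ℝ → ℝ) (xc : ℝ), IsTortoiseRadius M r xc → ∀ (s ℓ : ℕ), s ≤ 2 → s ≤ ℓ → ∀ ψ : ℝ → ℝ → ℝ, IsRWSolution M s ℓ r ψ → CauchyDataSupportedOn ψ {x : ℝ | ρ < |x - xc|} → ENNReal.ofReal c * totalEnergy (linePotential M s ℓ r) ψ 0 ≤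 channelEnergy (linePotential M s ℓ r) xc (ρ - h) ψ Filter.atTop + channelEnergy (linePotential M s ℓ r) xc (ρ - h) ψ Filter.atBot) → θ * M * Real.log (M / ρ) ≤ h := by
  intro M hM θ hθ
  -- reduce to a positive exponent `θ₁ = max θ 1` (`1 < 3√3`)
  have h13 : (1 : ℝ) < 3 * Real.sqrt 3 := by
    have h : 1 < Real.sqrt 3 := by
      rw [show (1 : ℝ) = Real.sqrt 1 from Real.sqrt_one.symm]
      exact Real.sqrt_lt_sqrt zero_le_one (by norm_num)
    linarith
  obtain ⟨θ₁, hθ₁0, hθθ₁, hθ₁3⟩ : ∃ θ₁ : ℝ, 0 < θ₁ ∧ θ ≤ θ₁ ∧ θ₁ < 3 * Real.sqrt 3 :=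
    ⟨max θ 1, lt_max_of_lt_right one_pos, le_max_left _ _, max_lt hθ h13⟩
  obtain ⟨r, hr⟩ := exists_isTortoiseRadius hM 0
  have hqb : ∀ x, |(1 - 2 * M / r x) / r x ^ 2| ≤ 1 / (4 * M ^ 2) := fun x => by
    rw [abs_of_pos (photonQ_pos hr x)]; exact photonQ_le hr x
  obtain ⟨ρ₁, hρ₁, hlaw⟩ := lagLaw_core (q := fun x => (1 - 2 * M / r x) / r x ^ 2) hM hθ₁0 hθ₁3
    (contDiff_photonQ hr) (lipschitzWith_deriv_photonQ hr) (photonQ_pos hr) hqb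
    (fun x hx => deriv_photonQ_nonpos hr hx) (deriv_photonQ_center hr) (photonQ_center hr)
    (iteratedDeriv_two_photonQ_center hr)
  refine ⟨min ρ₁ M, lt_min hρ₁ hM, ?_⟩
  intro ρ hρ hρm h c hc hInner
  have hρ₁' : ρ < ρ₁ := lt_of_lt_of_le hρm (min_le_left _ _)
  have hρM : ρ < M := lt_of_lt_of_le hρm (min_le_right _ _)
  have hlog : 0 ≤ Real.log (M / ρ) := Real.log_nonneg ((one_le_div hρ).2 hρM.le)
  have hθ₁h : θ₁ * M * Real.log (M / ρ) ≤ h := by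
    refine hlaw ρ hρ hρ₁' h c hc ?_
    intro ℓ hℓ ψ hψ hdata
    have hψ' : IsRWSolution M 1 ℓ r ψ := by
      show IsSolution (linePotential M 1 ℓ r) ψ
      rw [linePotential_one_eq]
      exact hψ
    have hI := hInner r 0 hr 1 ℓ (by norm_num) hℓ ψ hψ' hdata
    rw [linePotential_one_eq] at hI
    exact hI
  calc θ * M * Real.log (M / ρ) ≤ θ₁ * M * Real.log (M / ρ) := by
        rw [mul_assoc, mul_assoc]
        exact mul_le_mul_of_nonneg_right hθθ₁ (mul_nonneg hM.le hlog)
    _ ≤ h := hθ₁h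

/-- **No bounded lag.** For every `M > 0` and every bound `H` it is NOT the case that every
excision radius `ρ > 0` admits a lag `h ≤ H` and a rate `c > 0` for which the body of
`WindowedShellChannels` holds: by the lag law any admissible lag is `≥ M log(M/ρ) → ∞` as `ρ → 0`.
In particular every constant-lag (or bounded-lag) form of the crux is false; the crux itself lets
`h` depend on `ρ` and is not decided by this. -/
theorem lagLaw_unbounded (M : ℝ) (hM : 0 < M) (H : ℝ) :
    ¬ ∀ ρ : ℝ, 0 < ρ → ∃ h : ℝ, h ≤ H ∧ ∃ c : ℝ, 0 < c ∧
      ∀ (r : ℝ → ℝ) (xc : ℝ), IsTortoiseRadius M r xc → ∀ (s ℓ : ℕ), s ≤ 2 → s ≤ ℓ →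
        ∀ ψ : ℝ → ℝ → ℝ, IsRWSolution M s ℓ r ψ → CauchyDataSupportedOn ψ {x : ℝ | ρ < |x - xc|} →
          ENNReal.ofReal c * totalEnergy (linePotential M s ℓ r) ψ 0
            ≤ channelEnergy (linePotential M s ℓ r) xc (ρ - h) ψ Filter.atTop
              + channelEnergy (linePotential M s ℓ r) xc (ρ - h) ψ Filter.atBot := by
  intro hyp
  have h13 : (1 : ℝ) < 3 * Real.sqrt 3 := by
    have h : 1 < Real.sqrt 3 := by
      rw [show (1 : ℝ) = Real.sqrt 1 from Real.sqrt_one.symm]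
      exact Real.sqrt_lt_sqrt zero_le_one (by norm_num)
    linarith
  obtain ⟨ρ₁, hρ₁, hlaw⟩ := stub_lagLawLogGrowth M hM 1 h13
  -- an excision radius below `ρ₁` with `M log(M/ρ) > H`
  obtain ⟨a, ha⟩ : ∃ a : ℝ, a = (|H| + 1) / M := ⟨_, rfl⟩
  have ha0 : 0 < a := by rw [ha]; positivity
  obtain ⟨ρ, hρdef⟩ : ∃ ρ : ℝ, ρ = min (ρ₁ / 2) (M * Real.exp (-a)) := ⟨_, rfl⟩
  have hρ : 0 < ρ := by rw [hρdef]; exact lt_min (by positivity) (by positivity)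
  have hρ₁' : ρ < ρ₁ := by
    rw [hρdef]; exact lt_of_le_of_lt (min_le_left _ _) (by linarith)
  have hbig : H < 1 * M * Real.log (M / ρ) := by
    have hρle : ρ ≤ M * Real.exp (-a) := by rw [hρdef]; exact min_le_right _ _
    have h1 : Real.exp a ≤ M / ρ := by
      rw [le_div_iff₀ hρ]
      calc Real.exp a * ρ ≤ Real.exp a * (M * Real.exp (-a)) :=
            mul_le_mul_of_nonneg_left hρle (Real.exp_pos a).le
        _ = M := by rw [Real.exp_neg]; field_simp
    have h2 : a ≤ Real.log (M / ρ) := by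
      have := Real.log_le_log (Real.exp_pos a) h1
      rwa [Real.log_exp] at this
    have h3 : M * a = |H| + 1 := by rw [ha]; field_simp
    have h4 := mul_le_mul_of_nonneg_left h2 hM.le
    rw [h3] at h4
    linarith [le_abs_self H]
  obtain ⟨h, hh, c, hc, hI⟩ := hyp ρ hρ
  have := hlaw ρ hρ hρ₁' h c hc hI
  linarith

/-- **The crux is false when made uniform in `ρ`** (`∃ h, c` before `∀ ρ`): this is the statement
`WindowedShellChannelsUniformInRho` of the standing adversary's work file
`Cruxes/WindowedShellChannels/Disproof.lean`, recorded there as the sorried near-miss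
`not_windowedShellChannels_uniform_in_rho` ("needs long-time transport near the barrier top") — now a
theorem, immediate from `lagLaw_unbounded`. -/
theorem not_windowedShellChannels_uniformInRho :
    ¬ ∀ M : ℝ, 0 < M → ∃ h : ℝ, 0 ≤ h ∧ ∃ c : ℝ, 0 < c ∧ ∀ ρ : ℝ, 0 < ρ → ∀ (r : ℝ → ℝ) (xc : ℝ),
      IsTortoiseRadius M r xc → ∀ (s ℓ : ℕ), s ≤ 2 → s ≤ ℓ → ∀ ψ : ℝ → ℝ → ℝ,
      IsRWSolution M s ℓ r ψ → CauchyDataSupportedOn ψ {x : ℝ | ρ < |x - xc|} →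
      ENNReal.ofReal c * totalEnergy (linePotential M s ℓ r) ψ 0 ≤
        channelEnergy (linePotential M s ℓ r) xc (ρ - h) ψ atTop +
          channelEnergy (linePotential M s ℓ r) xc (ρ - h) ψ atBot := by
  intro hyp
  obtain ⟨h, -, c, hc, H⟩ := hyp 1 one_pos
  exact lagLaw_unbounded 1 one_pos h fun ρ hρ => ⟨h, le_rfl, c, hc, H ρ hρ⟩

/-- **The crux is false without its support hypothesis**: this is the statement
`WindowedShellChannelsWithoutSupport` of the standing adversary's work file
`Cruxes/WindowedShellChannels/Disproof.lean` (data may live on the photon shell), recorded there as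
the sorried near-miss `windowedShellChannels_false_without_support`. Proof: a witness `(h, c)` of
the support-free body at `(M, ρ) = (1, 1)` witnesses the genuine body at `(1, ρ′)`, `ρ′ < 1`, with
lag `h − 1 + ρ′ ≤ h` (same aperture); the law at `θ = 1` forbids `log(1/ρ′) ≤ h` for small `ρ′`. -/
theorem not_windowedShellChannels_withoutSupport :
    ¬ ∀ M : ℝ, 0 < M → ∀ ρ : ℝ, 0 < ρ → ∃ h : ℝ, 0 ≤ h ∧ ∃ c : ℝ, 0 < c ∧ ∀ (r : ℝ → ℝ) (xc : ℝ),
      IsTortoiseRadius M r xc → ∀ (s ℓ : ℕ), s ≤ 2 → s ≤ ℓ → ∀ ψ : ℝ → ℝ → ℝ,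
      IsRWSolution M s ℓ r ψ →
      ENNReal.ofReal c * totalEnergy (linePotential M s ℓ r) ψ 0 ≤
        channelEnergy (linePotential M s ℓ r) xc (ρ - h) ψ atTop +
          channelEnergy (linePotential M s ℓ r) xc (ρ - h) ψ atBot := by
  intro hyp
  obtain ⟨h, -, c, hc, H⟩ := hyp 1 one_pos 1 one_pos
  have h13 : (1 : ℝ) < 3 * Real.sqrt 3 := by
    have h : 1 < Real.sqrt 3 := by
      rw [show (1 : ℝ) = Real.sqrt 1 from Real.sqrt_one.symm]
      exact Real.sqrt_lt_sqrt zero_le_one (by norm_num)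
    linarith
  obtain ⟨ρ₁, hρ₁, hlaw⟩ := stub_lagLawLogGrowth 1 one_pos 1 h13
  -- a small shell `ρ′ ≤ min(1, e^{−(|h|+1)})` below `ρ₁`
  obtain ⟨a, ha⟩ : ∃ a : ℝ, a = |h| + 1 := ⟨_, rfl⟩
  have ha0 : 0 < a := by rw [ha]; positivity
  obtain ⟨ρ', hρ'⟩ : ∃ ρ' : ℝ, ρ' = min (ρ₁ / 2) (min 1 (Real.exp (-a))) := ⟨_, rfl⟩
  have hρ'0 : 0 < ρ' := by
    rw [hρ']; exact lt_min (by positivity) (lt_min one_pos (Real.exp_pos _))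
  have hρ'₁ : ρ' < ρ₁ := by
    rw [hρ']; exact lt_of_le_of_lt (min_le_left _ _) (by linarith)
  have hρ'1 : ρ' ≤ 1 := by rw [hρ']; exact (min_le_right _ _).trans (min_le_left _ _)
  have hρ'a : ρ' ≤ Real.exp (-a) := by rw [hρ']; exact (min_le_right _ _).trans (min_le_right _ _)
  -- the genuine body at `(1, ρ′)` with lag `h − 1 + ρ′`
  have hI : ∀ (r : ℝ → ℝ) (xc : ℝ), IsTortoiseRadius 1 r xc → ∀ (s ℓ : ℕ), s ≤ 2 → s ≤ ℓ →
      ∀ ψ : ℝ → ℝ → ℝ, IsRWSolution 1 s ℓ r ψ → CauchyDataSupportedOn ψ {x : ℝ | ρ' < |x - xc|} →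
      ENNReal.ofReal c * totalEnergy (linePotential 1 s ℓ r) ψ 0
        ≤ channelEnergy (linePotential 1 s ℓ r) xc (ρ' - (h - 1 + ρ')) ψ Filter.atTop
          + channelEnergy (linePotential 1 s ℓ r) xc (ρ' - (h - 1 + ρ')) ψ Filter.atBot := by
    intro r xc hr s ℓ hs hsℓ ψ hψ _
    have e : ρ' - (h - 1 + ρ') = 1 - h := by ring
    rw [e]
    exact H r xc hr s ℓ hs hsℓ ψ hψ
  have hbound := hlaw ρ' hρ'0 hρ'₁ (h - 1 + ρ') c hc hI
  -- `log(1/ρ′) ≥ a = |h| + 1`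
  have hlog : a ≤ Real.log (1 / ρ') := by
    have h1 : Real.exp a ≤ 1 / ρ' := by
      rw [le_div_iff₀ hρ'0]
      calc Real.exp a * ρ' ≤ Real.exp a * Real.exp (-a) :=
            mul_le_mul_of_nonneg_left hρ'a (Real.exp_pos a).le
        _ = 1 := by rw [← Real.exp_add, add_neg_cancel, Real.exp_zero]
    have := Real.log_le_log (Real.exp_pos a) h1
    rwa [Real.log_exp] at this
  rw [one_mul, one_mul] at hbound
  have := le_abs_self h
  linarith

/-- **Registered sub-goal `stub_lagLawVariants` of stmt-FinalStateConjecture-14085**: the crux made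
uniform in `ρ` and the crux without its support hypothesis are both FALSE (bundled). -/
theorem stub_lagLawVariants : (¬ ∀ M : ℝ, 0 < M → ∃ h : ℝ, 0 ≤ h ∧ ∃ c : ℝ, 0 < c ∧ ∀ ρ : ℝ, 0 < ρ → ∀ (r : ℝ → ℝ) (xc : ℝ), IsTortoiseRadius M r xc → ∀ (s ℓ : ℕ), s ≤ 2 → s ≤ ℓ → ∀ ψ : ℝ → ℝ → ℝ, IsRWSolution M s ℓ r ψ → CauchyDataSupportedOn ψ {x : ℝ | ρ < |x - xc|} → ENNReal.ofReal c * totalEnergy (linePotential M s ℓ r) ψ 0 ≤ channelEnergy (linePotential M s ℓ r) xc (ρ - h) ψ Filter.atTop + channelEnergy (linePotential M s ℓ r) xc (ρ - h) ψ Filter.atBot) ∧ ¬ ∀ M : ℝ, 0 < M → ∀ ρ : ℝ, 0 < ρ → ∃ h : ℝ, 0 ≤ h ∧ ∃ c : ℝ, 0 < c ∧ ∀ (r : ℝ → ℝ) (xc : ℝ), IsTortoiseRadius M r xc → ∀ (s ℓ : ℕ), s ≤ 2 → s ≤ ℓ → ∀ ψ : ℝ → ℝ → ℝ, IsRWSolution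 M s ℓ r ψ → ENNReal.ofReal c * totalEnergy (linePotential M s ℓ r) ψ 0 ≤ channelEnergy (linePotential M s ℓ r) xc (ρ - h) ψ Filter.atTop + channelEnergy (linePotential M s ℓ r) xc (ρ - h) ψ Filter.atBot :=
  ⟨not_windowedShellChannels_uniformInRho, not_windowedShellChannels_withoutSupport⟩

end Summit.FinalStateConjecture.FinalStateConjecture.Theorems.LagLaw
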